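import Mathlib
import Summits.Ventures.PercRepro2.Defs
import Summits.Ventures.PercRepro2.Graph

/-!
# Reachability by iterated neighbourhood closure: a polynomial decision procedure for `Conn`
(blind cell PercRepro2, mine-1 g49)

Mathlib decides `SimpleGraph.Reachable` on a finite graph by enumerating all walks of length below
the number of vertices (`reachable_iff_exists_finsetWalkLength_nonempty`), which the kernel cannot
evaluate on seven vertices and `2⁸` configurations within a proof.  `reach G u n` is the set of
vertices reached from `u` within `n` steps of the neighbourhood closure `step G S = S ∪ N(S)`;
`reachable_iff_mem_reach` says `G.Reachable u v ↔ v ∈ reach G u (card V)` (a walk shortens to a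
path of length `< card V`, `Walk.IsPath.length_lt`; every vertex of `reach` is reached by a walk).
`decConn` is the resulting decision of the cell's `Conn` — `7 · 7 · 7` adjacency tests on seven
vertices instead of `7⁶` walks — used by the witness files for the six mixed boxes.  One definition
(`step`, `reach`), no instances declared globally (`decConn` is a `def`, to be installed per
witness file), no notation.
-/

namespace Summit.Ventures.PercRepro2

namespace Reach

variable {V : Type*} [Fintype V] [DecidableEq V] (G : SimpleGraph V) [DecidableRel G.Adj]

/-- One closure step: `S` together with every neighbour of `S`. -/
def step (S : Finset V) : Finset V := S ∪ Finset.univ.filter (fun v => ∃ u ∈ S, G.Adj u v)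

/-- The vertices reached from `u` within `n` closure steps. -/
def reach (u : V) : ℕ → Finset V
  | 0 => {u}
  | n + 1 => step G (reach u n)

/-- `S ⊆ step G S`. -/
lemma subset_step (S : Finset V) : S ⊆ step G S := Finset.subset_union_left

/-- `step` is monotone. -/
lemma step_mono {S T : Finset V} (h : S ⊆ T) : step G S ⊆ step G T := by
  intro v hv
  simp only [step, Finset.mem_union, Finset.mem_filter, Finset.mem_univ, true_and] at hv ⊢
  rcases hv with hv | ⟨u, hu, huv⟩
  · exact Or.inl (h hv)
  · exact Or.inr ⟨u, h hu, huv⟩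

/-- A neighbour of a member of `S` lies in `step G S`. -/
lemma mem_step_of_adj {S : Finset V} {a b : V} (ha : a ∈ S) (hab : G.Adj a b) : b ∈ step G S := by
  simp only [step, Finset.mem_union, Finset.mem_filter, Finset.mem_univ, true_and]
  exact Or.inr ⟨a, ha, hab⟩

/-- `reach` is monotone in the number of steps. -/
lemma reach_mono {u : V} {m n : ℕ} (h : m ≤ n) : reach G u m ⊆ reach G u n := by
  induction h with
  | refl => exact le_rfl
  | step _ ih => exact ih.trans (subset_step G _)

/-- Everything reached from a neighbour `x` of `u` within `n` steps is reached from `u` within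
`n + 1` steps. -/
lemma reach_adj_subset {u x : V} (hux : G.Adj u x) : ∀ n, reach G x n ⊆ reach G u (n + 1)
  | 0 => by
      intro v hv
      simp only [reach, Finset.mem_singleton] at hv
      subst hv
      exact mem_step_of_adj G (Finset.mem_singleton_self u) hux
  | n + 1 => step_mono G (reach_adj_subset hux n)

/-- The end of a walk of length `n` from `u` lies in `reach G u n`. -/
lemma mem_reach_of_walk {u v : V} (p : G.Walk u v) : v ∈ reach G u p.length := by
  induction p with
  | nil => simp [reach]
  | cons h p ih => exact reach_adj_subset G h _ ih

/-- Every vertex of `reach G u n` is reachable from `u`. -/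
lemma reachable_of_mem_reach {u v : V} : ∀ n, v ∈ reach G u n → G.Reachable u v
  | 0, hv => by
      simp only [reach, Finset.mem_singleton] at hv
      subst hv
      exact SimpleGraph.Reachable.refl _
  | n + 1, hv => by
      simp only [reach, step, Finset.mem_union, Finset.mem_filter, Finset.mem_univ, true_and] at hv
      rcases hv with hv | ⟨a, ha, hav⟩
      · exact reachable_of_mem_reach n hv
      · exact (reachable_of_mem_reach n ha).trans hav.reachable

/-- **Reachability is membership in the `card V`-fold closure.** -/
theorem reachable_iff_mem_reach (u v : V) :
    G.Reachable u v ↔ v ∈ reach G u (Fintype.card V) := by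
  constructor
  · intro h
    refine h.elim_path fun p => ?_
    exact reach_mono G (le_of_lt p.isPath.length_lt) (mem_reach_of_walk G p.1)
  · exact reachable_of_mem_reach G _

end Reach

section DecConn

variable {V : Type*} {E : Type*} [Fintype E] [DecidableEq V] [Fintype V]

/-- The polynomial decision of `Conn`: membership in the iterated closure of the open graph
(a `def`, installed as a local instance by the files that need it). -/
def decConn (ends : E → Sym2 V) (ω : Config E) (u v : V) : Decidable (Conn ends ω u v) :=
  decidable_of_iff' (v ∈ Reach.reach (openGraph ends ω) u (Fintype.card V))
    (Reach.reachable_iff_mem_reach (openGraph ends ω) u v)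

end DecConn

end Summit.Ventures.PercRepro2
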